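import Summits.CriticalPhenomena.PercolationContinuityZ3.Theorems.PercNearOneGluingNoHeavyQuantIndepBlobGapRow
import HarnessLib

/-!
# QUANT lane R8, FAR on trees: the SLIVER form of the two-point-hub inequality TP1 (= (B-4) of the profile conjecture),
# reduced to two half-row-type rows of the block sum, with the `λ < 1/2` half closed by a closed-mass Markov bound

builds on p205010 (kernel theorem, internal audit signed; external expert review pending)

Support file (`--supports stmt-CriticalPhenomena-4575`), QUANT lane seat prim-quant-census-1 (gen 11); memo
`run/shared/lean/prim/quant/prim-quant-census-1/B4-SLIVER-G11.md` §1–§2 (+ §5 for the Markov corner).  Theorems only; no sorries; standard axioms.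

**Setting** (memo §1, blob vocabulary of `…QuantIndepBlobFarMin`).  `W = Σ_k a_k ζ_k`: independent blobs with integer sizes `a k ≥ 1` and
gates `p k`, least reliable blob `y₀` (`g := p y₀ ≤ p k`), tails `P(t ≤ W) = Σ_{s : t ≤ a(s)} w(s)`.  The last open piece (B-4) of census-1
gen 10's proof of `Quant.HubBlocksProfileIneq` (PROFILE-PROOF-G10 §11) is, by census-2 gen 46's vertex reduction (TP-REDUCTION-SURPLUS-FAR R1),
the two-point-hub inequality TP1 in the SLIVER regime: integers `1 ≤ i`, `i + 1 ≤ c`, `c + 1 ≤ y`, a real `d ∈ (0,1)` with `i + d < c`,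
and `EW > 2y − 2 − d` (so `EW > 2y − 3`: less than one unit short of block-star FAR at level `y`); with `λ = (i+d)/c` and `ρ = (2i+d)/(i+c)`
the claim is  `min(ρ, g) ≤ (1 − λ)·P(y ≤ W) + λ·P(y − c ≤ W)`  (hub `Y ∈ {i, i+c}` of mean `2i + d`, level `s = y + i`).

* `Quant.IndepBlob.tail_mono` — `t ≤ t' ⟹ P(t' ≤ W) ≤ P(t ≤ W)`.
* `Quant.IndepBlob.lowerTail_mul_le_closedMass` — Markov for the CLOSED mass: `P(a(W) ≤ j) · (Σ_k a_k − j) ≤ Σ_k a_k (1 − p_k)` (`j` real).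
* `Quant.IndepBlob.tail_ge_gate_of_two_mul_le_size` — all gates `≥ 1/2` and `2y ≤ Σ_k a_k` ⟹ `g ≤ P(y ≤ W)` (one gap row `λ = η = y`;
  no hypothesis on the mean: in the Hall–Harris regime only the total size matters).
* `Quant.IndepBlob.twoPointHub_sliver_of_rows` — **TP1-sliver from two rows** (memo §2, every step certified on 817 011 exact instances):
  given the two-level row `(A')  c ≤ 2(i+d) → 2g ≤ P(y ≤ W) + P(y−2 ≤ W)` and the sharp half-row in the large-size corner
  `(S)  2(i+d) < c → 2y ≤ Σ a → min(ρ, g) ≤ P(y ≤ W)`, the claim holds.  Case `λ ≥ 1/2`: `P(y−c ≤ W) ≥ P(y−2 ≤ W) ≥ 2g − P(y ≤ W)`, so the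
  left side is `≥ 2λg + (1−2λ)P(y ≤ W) ≥ g` once `P(y ≤ W) < g`.  Case `λ < 1/2` and `Σ a ≤ 2y − 1`: by the Markov bound,
  `P(W ≤ y−1) < (Σa − 2y + 2 + d)/(Σa − y + 1) ≤ (1+d)/y ≤ (1+d)/(c+1) < (c−i−d)/(i+c) = 1 − ρ` (using `c > 2(i+d)`, `i ≥ 1`), so `P(y ≤ W) > ρ`.
  The rows are kernel theorems in the regimes: (A') all gates `≥ 1/2` (`…QuantIndepBlobTwoLevelRow`), all gates `≤ 1/2`
  (`…QuantIndepBlobTwoLevelRowLow`, even with `y − 1`); (S) all gates `≥ 1/2` (`tail_ge_gate_of_two_mul_le_size` here).  Open: (A') with gates on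
  both sides of `1/2`, (S) with least gate `< 1/2` (memo §5; numerical slack ≥ 1.29 there).
[this work]
-/

namespace Summit.CriticalPhenomena.PercolationContinuityZ3.Theorems

namespace Quant

namespace IndepBlob

open Finset

variable {κ : Type*} [Fintype κ] [DecidableEq κ]

/-- Tails are monotone in the level: `t ≤ t' ⟹ P(t' ≤ W) ≤ P(t ≤ W)`. [folklore] -/
theorem tail_mono (p : κ → ℝ) (a : κ → ℕ) (hp0 : ∀ k, 0 ≤ p k) (hp1 : ∀ k, p k ≤ 1) {t t' : ℕ} (htt : t ≤ t') :
    ∑ s ∈ (Finset.univ : Finset (Finset κ)).filter (fun s => t' ≤ ∑ k ∈ s, a k), (∏ k, if k ∈ s then p k else 1 - p k) ≤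
      ∑ s ∈ (Finset.univ : Finset (Finset κ)).filter (fun s => t ≤ ∑ k ∈ s, a k), (∏ k, if k ∈ s then p k else 1 - p k) := by
  refine Finset.sum_le_sum_of_subset_of_nonneg (fun s hs => ?_) fun s _ _ => bernoulliWeight_nonneg hp0 hp1 s
  rw [Finset.mem_filter] at hs ⊢
  exact ⟨hs.1, htt.trans hs.2⟩

/-- **Markov's inequality for the closed mass.**  For gates `0 ≤ p k ≤ 1`, integer sizes `a k` with total `T = Σ_k a k`, and a real `j`:
`P(a(W) ≤ j) · (T − j) ≤ Σ_k a_k (1 − p_k)` — on `{a(W) ≤ j}` the closed mass `T − a(W)` is `≥ T − j`, and its mean is `Σ a_k (1 − p_k)`. [folklore] -/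
theorem lowerTail_mul_le_closedMass (p : κ → ℝ) (a : κ → ℕ) (hp0 : ∀ k, 0 ≤ p k) (hp1 : ∀ k, p k ≤ 1) (j : ℝ) :
    (∑ s ∈ (Finset.univ : Finset (Finset κ)).filter (fun s => ∑ k ∈ s, (a k : ℝ) ≤ j), (∏ k, if k ∈ s then p k else 1 - p k)) *
        ((∑ k, (a k : ℝ)) - j) ≤ ∑ k, (a k : ℝ) * (1 - p k) := by
  set T : ℝ := ∑ k, (a k : ℝ) with hT
  have hw0 : ∀ s : Finset κ, 0 ≤ (∏ k, if k ∈ s then p k else 1 - p k) := bernoulliWeight_nonneg hp0 hp1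
  have hsub : ∀ s : Finset κ, ∑ k ∈ s, (a k : ℝ) ≤ T := fun s =>
    Finset.sum_le_univ_sum_of_nonneg fun k => by positivity
  -- `E[T − a(W)] = Σ a (1 − p)`
  have hmean : ∑ s : Finset κ, (∏ k, if k ∈ s then p k else 1 - p k) * (T - ∑ k ∈ s, (a k : ℝ)) = ∑ k, (a k : ℝ) * (1 - p k) := by
    have e : ∀ s : Finset κ, (∏ k, if k ∈ s then p k else 1 - p k) * (T - ∑ k ∈ s, (a k : ℝ)) =
        (∏ k, if k ∈ s then p k else 1 - p k) * T - (∏ k, if k ∈ s then p k else 1 - p k) * ∑ k ∈ s, (a k : ℝ) := fun s => by ring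
    rw [Finset.sum_congr rfl fun s _ => e s, Finset.sum_sub_distrib, ← Finset.sum_mul, sum_bernoulliWeight, one_mul,
      sum_bernoulliWeight_mul_count p (fun k => (a k : ℝ))]
    rw [hT, ← Finset.sum_sub_distrib]
    exact Finset.sum_congr rfl fun k _ => by ring
  calc (∑ s ∈ (Finset.univ : Finset (Finset κ)).filter (fun s => ∑ k ∈ s, (a k : ℝ) ≤ j),
          (∏ k, if k ∈ s then p k else 1 - p k)) * (T - j)
      = ∑ s ∈ (Finset.univ : Finset (Finset κ)).filter (fun s => ∑ k ∈ s, (a k : ℝ) ≤ j),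
          (∏ k, if k ∈ s then p k else 1 - p k) * (T - j) := Finset.sum_mul _ _ _
    _ ≤ ∑ s ∈ (Finset.univ : Finset (Finset κ)).filter (fun s => ∑ k ∈ s, (a k : ℝ) ≤ j),
          (∏ k, if k ∈ s then p k else 1 - p k) * (T - ∑ k ∈ s, (a k : ℝ)) := by
        refine Finset.sum_le_sum fun s hs => ?_
        rw [Finset.mem_filter] at hs
        exact mul_le_mul_of_nonneg_left (by linarith [hs.2]) (hw0 s)
    _ ≤ ∑ s : Finset κ, (∏ k, if k ∈ s then p k else 1 - p k) * (T - ∑ k ∈ s, (a k : ℝ)) :=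
        Finset.sum_le_sum_of_subset_of_nonneg (Finset.filter_subset _ _)
          fun s _ _ => mul_nonneg (hw0 s) (by linarith [hsub s])
    _ = ∑ k, (a k : ℝ) * (1 - p k) := hmean

/-- **All gates `≥ 1/2` and total size `≥ 2y` give `P(y ≤ W) ≥ g`** (one two-threshold transport row `λ = η = y` of
`gapRow_of_half_le_gate`; no hypothesis on the mean). [this work] -/
theorem tail_ge_gate_of_two_mul_le_size (p : κ → ℝ) (a : κ → ℕ) (hp0 : ∀ k, 0 ≤ p k) (hp1 : ∀ k, p k ≤ 1)
    (y₀ : κ) (hy₀ : ∀ k, p y₀ ≤ p k) (hhalf : 1 / 2 ≤ p y₀) (y : ℕ) (hT : 2 * y ≤ ∑ k, a k) :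
    p y₀ ≤ ∑ s ∈ (Finset.univ : Finset (Finset κ)).filter (fun s => y ≤ ∑ k ∈ s, a k), (∏ k, if k ∈ s then p k else 1 - p k) := by
  have hw0 : ∀ s : Finset κ, 0 ≤ (∏ k, if k ∈ s then p k else 1 - p k) := bernoulliWeight_nonneg hp0 hp1
  have hrow := gapRow_of_half_le_gate p (fun k => (a k : ℝ)) (p y₀) hhalf (hp1 y₀) hy₀ hp1 (fun k => by positivity)
    (y : ℝ) (y : ℝ) le_rfl (by
      have : ((2 * y : ℕ) : ℝ) ≤ ((∑ k, a k : ℕ) : ℝ) := by exact_mod_cast hT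
      push_cast at this
      linarith)
  -- identify the two events with integer thresholds and use `P(W < y) + P(y ≤ W) = 1`
  have hH : ∑ V ∈ (Finset.univ : Finset (Finset κ)).filter (fun V => (y : ℝ) ≤ ∑ i ∈ V, (a i : ℝ)),
      (∏ k, if k ∈ V then p k else 1 - p k) =
      ∑ s ∈ (Finset.univ : Finset (Finset κ)).filter (fun s => y ≤ ∑ k ∈ s, a k), (∏ k, if k ∈ s then p k else 1 - p k) := by
    refine Finset.sum_congr (Finset.filter_congr fun s _ => ?_) fun _ _ => rfl
    constructor
    · intro h
      have : ((y : ℕ) : ℝ) ≤ ((∑ k ∈ s, a k : ℕ) : ℝ) := by push_cast; exact h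
      exact_mod_cast this
    · intro h
      have : ((y : ℕ) : ℝ) ≤ ((∑ k ∈ s, a k : ℕ) : ℝ) := by exact_mod_cast h
      push_cast at this
      exact this
  have hL : ∑ V ∈ (Finset.univ : Finset (Finset κ)).filter (fun V => ∑ i ∈ V, (a i : ℝ) < (y : ℝ)),
      (∏ k, if k ∈ V then p k else 1 - p k) =
      ∑ s ∈ (Finset.univ : Finset (Finset κ)).filter (fun s => ¬ (y ≤ ∑ k ∈ s, a k)), (∏ k, if k ∈ s then p k else 1 - p k) := by
    refine Finset.sum_congr (Finset.filter_congr fun s _ => ?_) fun _ _ => rfl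
    rw [not_le]
    constructor
    · intro h
      have : ((∑ k ∈ s, a k : ℕ) : ℝ) < ((y : ℕ) : ℝ) := by push_cast; exact h
      exact_mod_cast this
    · intro h
      have : ((∑ k ∈ s, a k : ℕ) : ℝ) < ((y : ℕ) : ℝ) := by exact_mod_cast h
      push_cast at this
      exact this
  have hcompl := Finset.sum_filter_add_sum_filter_not (Finset.univ : Finset (Finset κ))
    (fun s => y ≤ ∑ k ∈ s, a k) (fun s => (∏ k, if k ∈ s then p k else 1 - p k))
  rw [sum_bernoulliWeight p] at hcompl
  rw [hH, hL] at hrow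
  nlinarith [hrow, hcompl, hp0 y₀, hp1 y₀]

/-- **TP1 in the sliver, from two rows of the block sum** (memo B4-SLIVER-G11 §2).  Data: gates `0 ≤ p k ≤ 1`, integer sizes `a k`, a
distinguished blob `y₀` (in applications the least reliable one), `g = p y₀`; integers `1 ≤ i`, `i + 1 ≤ c`, `c + 1 ≤ y`; a real `d` with `0 < d < 1`, `i + d < c`; the sliver hypothesis `2y − 2 − d < EW`.
Rows assumed: `(A')` if `c ≤ 2(i+d)` then `2g ≤ P(y ≤ W) + P(y−2 ≤ W)`; `(S)` if `2(i+d) < c` and `2y ≤ Σ a` then `min(ρ, g) ≤ P(y ≤ W)`.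
Conclusion: `min(ρ, g) ≤ (1 − λ)·P(y ≤ W) + λ·P(y − c ≤ W)` with `λ = (i+d)/c`, `ρ = (2i+d)/(i+c)`.
(The remaining corner `2(i+d) < c`, `Σ a ≤ 2y − 1` is settled inside by `lowerTail_mul_le_closedMass`.) [this work] -/
theorem twoPointHub_sliver_of_rows (p : κ → ℝ) (a : κ → ℕ) (hp0 : ∀ k, 0 ≤ p k) (hp1 : ∀ k, p k ≤ 1)
    (y₀ : κ) (i c y : ℕ) (d : ℝ) (hi : 1 ≤ i) (hic : i + 1 ≤ c) (hcy : c + 1 ≤ y)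
    (hd0 : 0 < d) (hd1 : d < 1) (hdc : (i : ℝ) + d < c)
    (hEW : 2 * (y : ℝ) - 2 - d < ∑ k, (a k : ℝ) * p k)
    (hA : (c : ℝ) ≤ 2 * ((i : ℝ) + d) → 2 * p y₀ ≤
      ∑ s ∈ (Finset.univ : Finset (Finset κ)).filter (fun s => y ≤ ∑ k ∈ s, a k), (∏ k, if k ∈ s then p k else 1 - p k) +
        ∑ s ∈ (Finset.univ : Finset (Finset κ)).filter (fun s => y - 2 ≤ ∑ k ∈ s, a k), (∏ k, if k ∈ s then p k else 1 - p k))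
    (hS : 2 * ((i : ℝ) + d) < c → 2 * y ≤ ∑ k, a k → min ((2 * (i : ℝ) + d) / ((i : ℝ) + c)) (p y₀) ≤
      ∑ s ∈ (Finset.univ : Finset (Finset κ)).filter (fun s => y ≤ ∑ k ∈ s, a k), (∏ k, if k ∈ s then p k else 1 - p k)) :
    min ((2 * (i : ℝ) + d) / ((i : ℝ) + c)) (p y₀) ≤
      (1 - ((i : ℝ) + d) / c) *
          ∑ s ∈ (Finset.univ : Finset (Finset κ)).filter (fun s => y ≤ ∑ k ∈ s, a k), (∏ k, if k ∈ s then p k else 1 - p k) +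
        (((i : ℝ) + d) / c) *
          ∑ s ∈ (Finset.univ : Finset (Finset κ)).filter (fun s => y - c ≤ ∑ k ∈ s, a k), (∏ k, if k ∈ s then p k else 1 - p k) := by
  set g : ℝ := p y₀ with hg
  set lam : ℝ := ((i : ℝ) + d) / c with hlam
  set ρ : ℝ := (2 * (i : ℝ) + d) / ((i : ℝ) + c) with hρ
  set P0 : ℝ := ∑ s ∈ (Finset.univ : Finset (Finset κ)).filter (fun s => y ≤ ∑ k ∈ s, a k),
      (∏ k, if k ∈ s then p k else 1 - p k) with hP0
  set P2 : ℝ := ∑ s ∈ (Finset.univ : Finset (Finset κ)).filter (fun s => y - 2 ≤ ∑ k ∈ s, a k),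
      (∏ k, if k ∈ s then p k else 1 - p k) with hP2
  set Pc : ℝ := ∑ s ∈ (Finset.univ : Finset (Finset κ)).filter (fun s => y - c ≤ ∑ k ∈ s, a k),
      (∏ k, if k ∈ s then p k else 1 - p k) with hPc
  have hw0 : ∀ s : Finset κ, 0 ≤ (∏ k, if k ∈ s then p k else 1 - p k) := bernoulliWeight_nonneg hp0 hp1
  have hc0 : (0 : ℝ) < c := by
    have : (2 : ℝ) ≤ c := by exact_mod_cast (by omega : 2 ≤ c)
    linarith
  have hi1 : (1 : ℝ) ≤ i := by exact_mod_cast hi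
  have hic' : (i : ℝ) + 1 ≤ c := by exact_mod_cast hic
  have hcy' : (c : ℝ) + 1 ≤ y := by exact_mod_cast hcy
  have hlam0 : 0 ≤ lam := by rw [hlam]; positivity
  have hlam1 : lam ≤ 1 := by rw [hlam, div_le_one hc0]; linarith
  -- monotonicity: `P0 ≤ P2 ≤ Pc`
  have hP0P2 : P0 ≤ P2 := tail_mono p a hp0 hp1 (by omega)
  have hP2Pc : P2 ≤ Pc := tail_mono p a hp0 hp1 (by omega)
  have hP0Pc : P0 ≤ Pc := hP0P2.trans hP2Pc
  -- the left side dominates `P0`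
  have hLHSP0 : P0 ≤ (1 - lam) * P0 + lam * Pc := by nlinarith
  by_cases hcase : (c : ℝ) ≤ 2 * ((i : ℝ) + d)
  · -- `λ ≥ 1/2`: row (A')
    have hA' := hA hcase
    have hlamhalf : 1 / 2 ≤ lam := by
      rw [hlam, le_div_iff₀ hc0]; linarith
    by_cases htriv : min ρ g ≤ P0
    · exact htriv.trans hLHSP0
    · push Not at htriv
      have hP0g : P0 < g := lt_of_lt_of_le htriv (min_le_right _ _)
      -- `(1 − λ) P0 + λ Pc ≥ (1 − λ) P0 + λ (2g − P0) = 2λ g + (1 − 2λ) P0 ≥ g`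
      have h1 : 2 * g - P0 ≤ Pc := by linarith
      have h2 : (1 - lam) * P0 + lam * (2 * g - P0) ≤ (1 - lam) * P0 + lam * Pc := by nlinarith
      have h3 : g ≤ (1 - lam) * P0 + lam * (2 * g - P0) := by nlinarith
      exact (min_le_right _ _).trans (h3.trans h2)
  · -- `λ < 1/2`
    push Not at hcase
    by_cases hT : 2 * y ≤ ∑ k, a k
    · exact (hS hcase hT).trans hLHSP0
    · -- `Σ a ≤ 2y − 1`: Markov for the closed mass gives `P(W ≤ y − 1) < 1 − ρ`
      push Not at hT
      set T : ℝ := ∑ k, (a k : ℝ) with hTdef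
      have hTle : T ≤ 2 * (y : ℝ) - 1 := by
        have hn : ∑ k, a k + 1 ≤ 2 * y := by omega
        have : ((∑ k, a k + 1 : ℕ) : ℝ) ≤ ((2 * y : ℕ) : ℝ) := by exact_mod_cast hn
        push_cast at this
        linarith
      have hEWleT : ∑ k, (a k : ℝ) * p k ≤ T := by
        rw [hTdef]
        refine Finset.sum_le_sum fun k _ => ?_
        have := hp1 k
        have : (0 : ℝ) ≤ a k := by positivity
        nlinarith
      have hTge : 2 * (y : ℝ) - 2 - d < T := lt_of_lt_of_le hEW hEWleT
      -- the lower tail `L = P(a(W) ≤ y − 1) = 1 − P0`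
      set L : ℝ := ∑ s ∈ (Finset.univ : Finset (Finset κ)).filter (fun s => ∑ k ∈ s, (a k : ℝ) ≤ (y : ℝ) - 1),
          (∏ k, if k ∈ s then p k else 1 - p k) with hL
      have hLP0 : L + P0 = 1 := by
        have hcompl := Finset.sum_filter_add_sum_filter_not (Finset.univ : Finset (Finset κ))
          (fun s => y ≤ ∑ k ∈ s, a k) (fun s => (∏ k, if k ∈ s then p k else 1 - p k))
        rw [sum_bernoulliWeight p] at hcompl
        have he : (Finset.univ : Finset (Finset κ)).filter (fun s => ¬ (y ≤ ∑ k ∈ s, a k)) =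
            (Finset.univ : Finset (Finset κ)).filter (fun s => ∑ k ∈ s, (a k : ℝ) ≤ (y : ℝ) - 1) := by
          refine Finset.filter_congr fun s _ => ?_
          rw [not_le]
          constructor
          · intro h
            have h' : ∑ k ∈ s, a k + 1 ≤ y := by omega
            have : ((∑ k ∈ s, a k + 1 : ℕ) : ℝ) ≤ ((y : ℕ) : ℝ) := by exact_mod_cast h'
            push_cast at this
            linarith
          · intro h
            have : ((∑ k ∈ s, a k : ℕ) : ℝ) + 1 ≤ (y : ℝ) := by push_cast; linarith
            have h' : ((∑ k ∈ s, a k + 1 : ℕ) : ℝ) ≤ ((y : ℕ) : ℝ) := by push_cast; linarith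
            have h'' : ∑ k ∈ s, a k + 1 ≤ y := by exact_mod_cast h'
            omega
        rw [he] at hcompl
        rw [hL, hP0]
        linarith
      -- Markov: `L · (T − (y − 1)) ≤ Σ a (1 − p) = T − EW < T − (2y − 2 − d)`
      have hmk := lowerTail_mul_le_closedMass p a hp0 hp1 ((y : ℝ) - 1)
      have hclosed : ∑ k, (a k : ℝ) * (1 - p k) = T - ∑ k, (a k : ℝ) * p k := by
        rw [hTdef, ← Finset.sum_sub_distrib]
        exact Finset.sum_congr rfl fun k _ => by ring
      rw [hclosed] at hmk
      have hL0 : 0 ≤ L := Finset.sum_nonneg fun s _ => hw0 s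
      -- `L · (T − y + 1) < T − 2y + 2 + d`
      have hmk' : L * (T - ((y : ℝ) - 1)) < T - (2 * (y : ℝ) - 2 - d) := by linarith
      -- hence `L < 1 − ρ`; we show `L · (T − y + 1) · stuff` by cross-multiplication
      have hTy : 0 < T - ((y : ℝ) - 1) := by linarith
      -- (1) `(T − 2y + 2 + d) · y ≤ (1 + d) · (T − y + 1)`  since `T ≤ 2y − 1`, `y ≥ 2`, `d < 1`
      have hy2 : (2 : ℝ) ≤ y := by linarith
      have hy0 : (0 : ℝ) < y := by linarith
      have hc1 : (0 : ℝ) < (c : ℝ) + 1 := by linarith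
      have hic0 : (0 : ℝ) < (i : ℝ) + c := by linarith
      -- (1) `(T − 2y + 2 + d) · y ≤ (1 + d) · (T − y + 1)`: the difference is `(y − 1 − d)(2y − 1 − T) ≥ 0`
      have step1 : (T - (2 * (y : ℝ) - 2 - d)) * (y : ℝ) ≤ (1 + d) * (T - ((y : ℝ) - 1)) := by
        have e : (1 + d) * (T - ((y : ℝ) - 1)) - (T - (2 * (y : ℝ) - 2 - d)) * (y : ℝ) =
            ((y : ℝ) - 1 - d) * (2 * (y : ℝ) - 1 - T) := by ring
        have : 0 ≤ ((y : ℝ) - 1 - d) * (2 * (y : ℝ) - 1 - T) := mul_nonneg (by linarith) (by linarith)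
        linarith
      -- (2) `(1 + d)(i + c) ≤ (c + 1)(i + d)`: the difference is `(i − 1)(c − d) ≥ 0`
      have step2 : (1 + d) * ((i : ℝ) + c) ≤ ((c : ℝ) + 1) * ((i : ℝ) + d) := by
        have e : ((c : ℝ) + 1) * ((i : ℝ) + d) - (1 + d) * ((i : ℝ) + c) = ((i : ℝ) - 1) * ((c : ℝ) - d) := by ring
        have : 0 ≤ ((i : ℝ) - 1) * ((c : ℝ) - d) := mul_nonneg (by linarith) (by linarith)
        linarith
      -- (3) `(c + 1)(i + d) < (c + 1)(c − i − d)` since `c > 2(i + d)`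
      have step3 : ((c : ℝ) + 1) * ((i : ℝ) + d) < ((c : ℝ) + 1) * ((c : ℝ) - i - d) := by
        have h8 : 0 < ((c : ℝ) + 1) * ((c : ℝ) - i - d - ((i : ℝ) + d)) := mul_pos hc1 (by linarith)
        have e4 : ((c : ℝ) + 1) * ((c : ℝ) - i - d - ((i : ℝ) + d)) =
            ((c : ℝ) + 1) * ((c : ℝ) - i - d) - ((c : ℝ) + 1) * ((i : ℝ) + d) := by ring
        linarith only [h8, e4]
      -- `L · y < 1 + d`
      have hLy : L * (y : ℝ) < 1 + d := by
        have h1 : L * (T - ((y : ℝ) - 1)) * (y : ℝ) < (T - (2 * (y : ℝ) - 2 - d)) * (y : ℝ) :=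
          mul_lt_mul_of_pos_right hmk' hy0
        have h2 : L * (y : ℝ) * (T - ((y : ℝ) - 1)) < (1 + d) * (T - ((y : ℝ) - 1)) := by
          have e5 : L * (T - ((y : ℝ) - 1)) * (y : ℝ) = L * (y : ℝ) * (T - ((y : ℝ) - 1)) := by ring
          linarith only [h1, e5, step1]
        exact lt_of_mul_lt_mul_right h2 hTy.le
      -- `L · (c + 1) < 1 + d`
      have hLc : L * ((c : ℝ) + 1) < 1 + d := lt_of_le_of_lt (mul_le_mul_of_nonneg_left hcy' hL0) hLy
      -- `L · (i + c) < c − i − d`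
      have hLic : L * ((i : ℝ) + c) < (c : ℝ) - i - d := by
        have h5 : L * ((c : ℝ) + 1) * ((i : ℝ) + c) < (1 + d) * ((i : ℝ) + c) := mul_lt_mul_of_pos_right hLc hic0
        have h6 : L * ((i : ℝ) + c) * ((c : ℝ) + 1) < ((c : ℝ) - i - d) * ((c : ℝ) + 1) := by
          have e1 : L * ((c : ℝ) + 1) * ((i : ℝ) + c) = L * ((i : ℝ) + c) * ((c : ℝ) + 1) := by ring
          have e2 : ((c : ℝ) + 1) * ((c : ℝ) - i - d) = ((c : ℝ) - i - d) * ((c : ℝ) + 1) := by ring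
          linarith only [h5, e1, e2, step2, step3]
        exact lt_of_mul_lt_mul_right h6 hc1.le
      have hρ1 : ρ * ((i : ℝ) + c) = 2 * (i : ℝ) + d := by
        rw [hρ, div_mul_cancel₀ _ hic0.ne']
      have hLlt : L < 1 - ρ := by
        -- multiply by `i + c > 0`
        by_contra hcon
        push Not at hcon
        have h7 : (1 - ρ) * ((i : ℝ) + c) ≤ L * ((i : ℝ) + c) := mul_le_mul_of_nonneg_right hcon hic0.le
        have e3 : (1 - ρ) * ((i : ℝ) + c) = ((i : ℝ) + c) - ρ * ((i : ℝ) + c) := by ring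
        linarith only [h7, e3, hρ1, hLic]
      have hP0gt : ρ < P0 := by linarith
      exact (min_le_left _ _).trans (hP0gt.le.trans hLHSP0)
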